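import Literature.Computability.Complexity.TM2Iterate
import HarnessLib

/-!
# Running a polynomial-time machine on the first field of its input, keeping the context

Trunk `CplxCore`, toolkit for `TimeBounds.lean` (sibling of `TimeBoundsProofs.lean`, sequential
composition, and `TM2Iterate.lean`, clocked iteration). Main result:

* `Literature.Computability.Complexity.PolyTimeComputable.firstField`: if `f : α → β` is `PolyTimeComputable ea eb f`
  for encodings `ea`, `eb` over one alphabet `A` (nonempty), then for every *context* type `γ`
  with an encoding `ec : γ → List (Option A)` the map `(a, c) ↦ (f a, c)` is
  `PolyTimeComputable` from the word `(ea a).map some ++ none :: ec c` to the word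
  `(eb (f a)).map some ++ none :: ec c` (alphabet `Option A`: the *field* of `a` in data
  symbols `some _`, the terminator `none`, then the context verbatim).

This is the machine-level closure property "apply a subroutine to one component of the tape
and leave the rest untouched" (Arora–Barak 2009, §1.3–1.4: multi-tape machines running a
machine as a subroutine on a designated work tape), the missing companion of composition
(`PolyTimeComputable.comp_holds`) needed to build polynomial-time machines *compositionally*
on structured data (several strings on one tape): with `firstField` and `comp` a pipeline of
stages each rewriting a prefix field in the presence of an arbitrary typed context is
polynomial time as soon as each stage is. It is used for the error-reduction machine of `BPP`
(`(BPP, 𝒟) ⊆ HeurBPP`, `MetaComplexity/HeuristicClasses.lean`), where the decider of the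
underlying `P`-language is run on successive coin blocks while the sample, the clock and the
votes collected so far are kept as context. Nothing of this is in Mathlib.

## The context machine (`TM2Ctx.ctxTM`)

Given a bundled `M : Turing.FinTM2` with identifications `eIn : M.Γ M.k₀ ≃ A`,
`eOut : M.Γ M.k₁ ≃ A`, the context machine has stacks `M.K ⊕ Aux` with four auxiliary stacks
`IN` (its input stack, alphabet `Option A`), `TMP` (alphabet `A`), `CTX` and `OUT` (its output
stack; both alphabet `Option A`), labels `M.Λ ⊕ Ctrl` with eight control labels, and states
`M.σ × Option (Option A)` (a register for one popped symbol, reset between steps), exactly as in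
the loop machine `TM2Iter.iterTM`, whose statement translation and bookkeeping this file adapts.
Control flow (`TM2Ctx.ctrlStmt`):

* `init1`: pop `IN`; data symbols `some γ` go to `TMP` until the terminator `none` is met;
  `init2`: the rest of `IN` (the context) goes to `CTX`; `init3`: pour `TMP` onto `k₀` (two
  reversals restore the order) and jump to `M.main`. The statements of `M` act on the first
  state component (`TM2Ctx.trStmt`), `halt` becoming `goto out1`; `M` halts in `haltList` form
  (output on `k₁`, its other stacks empty, state reset).
* `out1`: pour `CTX` onto `OUT` (restoring the order of the context); `out2`: push the
  terminator `none`; `out3`: pour `k₁` onto `TMP`, `out4`: pour `TMP` onto `OUT` as data symbols;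
  `fin`: reset the state and `halt` — Mathlib's `haltList` convention, all stacks but `OUT`
  being empty again.

Total time `2|u| + 2|c| + 2|y| + m + 8` for input field `u`, context `c`, output field `y` and
`m` steps of `M`; with `|y| ≤ |u| + D m` (`OutputsWithin.length_le`) this is bounded by the
polynomial `ctxPoly p D = 6X + 8 + (2D + 1) p` in the input length.

## References

* S. Arora, B. Barak, *Computational Complexity: A Modern Approach*, CUP 2009, §1.3 (machine
  constructions, subroutines on multi-tape machines), Claim 1.6, proof of Thm. 2.8
  (polynomial-time computations compose). doi:10.1017/cbo9780511804090
* Mathlib, `Mathlib/Computability/TuringMachine/Computable.lean` (`FinTM2`, `initList`,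
  `haltList`, `TM2OutputsInTime`).
-/

namespace Literature.Computability.Complexity

namespace TM2Ctx

open Turing StateTransition Function TM2Comp TM2Iter

/-! ### The context machine: auxiliary stacks, control labels, alphabets -/

/-- The four auxiliary stacks of the context machine: the input stack `IN` (alphabet
`Option A`: `some γ` = data symbol of the first field, `none` = field terminator / context
symbol), the transfer stack `TMP` (alphabet `A`), the context stack `CTX` and the output stack
`OUT` (alphabet `Option A`). [folklore] -/
inductive Aux
  | IN
  | TMP
  | CTX
  | OUT
  deriving DecidableEq, Fintype

/-- The control labels of the context machine (besides the labels of the embedded machine).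
[folklore] -/
inductive Ctrl
  | init1
  | init2
  | init3
  | out1
  | out2
  | out3
  | out4
  | fin
  deriving DecidableEq, Fintype

section Machine

variable {K : Type} {G : K → Type} {Λ σ A : Type}

/-- Stack alphabets of the context machine: those of the embedded machine on `inl`, and
`Option A`, `A`, `Option A`, `Option A` on the auxiliary stacks `IN`, `TMP`, `CTX`, `OUT`.
Written with `casesOn` so that it unfolds by `rfl` on constructors. [folklore] -/
abbrev CtxΓ (G : K → Type) (A : Type) : K ⊕ Aux → Type := fun j =>
  Sum.casesOn (motive := fun _ => Type) j G
    (fun a => Aux.casesOn (motive := fun _ => Type) a (Option A) A (Option A) (Option A))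

/-- Read a tape symbol (`Option A`) back from the register (`none` if the register is empty).
[folklore] -/
def ijoin : Option (Option A) → Option A
  | some o => o
  | none => none

/-- Stack contents of the context machine from the stacks `S` of the embedded machine and the
contents `i`, `t`, `c`, `o` of `IN`, `TMP`, `CTX`, `OUT`. [folklore] -/
def mkStk (S : ∀ k, List (G k)) (i : List (Option A)) (t : List A) (c o : List (Option A)) :
    ∀ j : K ⊕ Aux, List (CtxΓ G A j)
  | Sum.inl k => S k
  | Sum.inr Aux.IN => i
  | Sum.inr Aux.TMP => t
  | Sum.inr Aux.CTX => c
  | Sum.inr Aux.OUT => o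

section StkLemmas

variable (S : ∀ k, List (G k)) (i : List (Option A)) (t : List A) (c o : List (Option A))

/-- Reading a stack of the embedded machine. [folklore] -/
@[simp] theorem mkStk_inl (k : K) : mkStk S i t c o (Sum.inl k) = S k := rfl
/-- Reading `IN`. [folklore] -/
@[simp] theorem mkStk_IN : mkStk S i t c o (Sum.inr Aux.IN) = i := rfl
/-- Reading `TMP`. [folklore] -/
@[simp] theorem mkStk_TMP : mkStk S i t c o (Sum.inr Aux.TMP) = t := rfl
/-- Reading `CTX`. [folklore] -/
@[simp] theorem mkStk_CTX : mkStk S i t c o (Sum.inr Aux.CTX) = c := rfl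
/-- Reading `OUT`. [folklore] -/
@[simp] theorem mkStk_OUT : mkStk S i t c o (Sum.inr Aux.OUT) = o := rfl

variable {dKA : DecidableEq (K ⊕ Aux)}

/-- Writing a stack of the embedded machine (any decidability instance on `K ⊕ Aux`, so that
the lemma also fires on the instance bundled in a `FinTM2`). [folklore] -/
@[simp] theorem mkStk_update_inl [DecidableEq K] (k : K) (L : List (G k)) :
    @update _ _ dKA (mkStk S i t c o) (Sum.inl k) L = mkStk (update S k L) i t c o := by
  funext j
  rcases j with k' | a
  · rcases eq_or_ne k' k with rfl | h
    · simp
    · rw [update_of_ne (by simpa using h)]; simp [update_of_ne h]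
  · rw [update_of_ne (by simp)]; cases a <;> rfl

/-- Writing `IN`. [folklore] -/
@[simp] theorem mkStk_update_IN (i' : List (Option A)) :
    @update _ _ dKA (mkStk S i t c o) (Sum.inr Aux.IN) i' = mkStk S i' t c o := by
  funext j
  rcases j with k' | a
  · rw [update_of_ne (by simp)]; rfl
  · cases a
    · simp
    all_goals rw [update_of_ne (by simp)]; rfl

/-- Writing `TMP`. [folklore] -/
@[simp] theorem mkStk_update_TMP (t' : List A) :
    @update _ _ dKA (mkStk S i t c o) (Sum.inr Aux.TMP) t' = mkStk S i t' c o := by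
  funext j
  rcases j with k' | a
  · rw [update_of_ne (by simp)]; rfl
  · cases a
    case TMP => simp
    all_goals rw [update_of_ne (by simp)]; rfl

/-- Writing `CTX`. [folklore] -/
@[simp] theorem mkStk_update_CTX (c' : List (Option A)) :
    @update _ _ dKA (mkStk S i t c o) (Sum.inr Aux.CTX) c' = mkStk S i t c' o := by
  funext j
  rcases j with k' | a
  · rw [update_of_ne (by simp)]; rfl
  · cases a
    case CTX => simp
    all_goals rw [update_of_ne (by simp)]; rfl

/-- Writing `OUT`. [folklore] -/
@[simp] theorem mkStk_update_OUT (o' : List (Option A)) :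
    @update _ _ dKA (mkStk S i t c o) (Sum.inr Aux.OUT) o' = mkStk S i t c o' := by
  funext j
  rcases j with k' | a
  · rw [update_of_ne (by simp)]; rfl
  · cases a
    case OUT => simp
    all_goals rw [update_of_ne (by simp)]; rfl

/-- The empty stack assignment. [folklore] -/
theorem mkStk_bot :
    mkStk (A := A) (fun k => ([] : List (G k))) [] [] [] [] =
      fun j => ([] : List (CtxΓ G A j)) := by
  funext j
  rcases j with k | a
  · rfl
  · cases a <;> rfl

/-- The initial stack assignment of the context machine (input word on `IN`). [folklore] -/
theorem mkStk_bot_IN [DecidableEq K] (l : List (Option A)) :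
    mkStk (fun k => ([] : List (G k))) l [] [] [] = update (fun j => ([] : List (CtxΓ G A j)))
      (Sum.inr Aux.IN) l := by
  rw [← mkStk_bot, mkStk_update_IN]

/-- The final stack assignment of the context machine (output word on `OUT`). [folklore] -/
theorem mkStk_bot_OUT [DecidableEq K] (l : List (Option A)) :
    mkStk (fun k => ([] : List (G k))) [] [] [] l = update (fun j => ([] : List (CtxΓ G A j)))
      (Sum.inr Aux.OUT) l := by
  rw [← mkStk_bot, mkStk_update_OUT]

end StkLemmas

/-- Translation of the statements of the embedded machine: act on the `inl` stacks and the
first state component; `halt` becomes a jump to the control label `out1`. [folklore] -/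
def trStmt : TM2.Stmt G Λ σ → TM2.Stmt (CtxΓ G A) (Λ ⊕ Ctrl) (St σ A)
  | TM2.Stmt.push k f q => TM2.Stmt.push (Sum.inl k) (fun s => f s.1) (trStmt q)
  | TM2.Stmt.peek k f q => TM2.Stmt.peek (Sum.inl k) (fun s x => (f s.1 x, s.2)) (trStmt q)
  | TM2.Stmt.pop k f q => TM2.Stmt.pop (Sum.inl k) (fun s x => (f s.1 x, s.2)) (trStmt q)
  | TM2.Stmt.load f q => TM2.Stmt.load (fun s => (f s.1, s.2)) (trStmt q)
  | TM2.Stmt.branch p q₁ q₂ => TM2.Stmt.branch (fun s => p s.1) (trStmt q₁) (trStmt q₂)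
  | TM2.Stmt.goto l => TM2.Stmt.goto fun s => Sum.inl (l s.1)
  | TM2.Stmt.halt => TM2.Stmt.goto fun _ => Sum.inr Ctrl.out1

/-- Configuration of the context machine while the embedded machine runs (auxiliary stacks
empty except the context stack `ctx`; the halting label is sent to `out1`). [folklore] -/
def cfgM (c : TM2.Cfg G Λ σ) (ctx : List (Option A)) : TM2.Cfg (CtxΓ G A) (Λ ⊕ Ctrl) (St σ A) :=
  ⟨some (c.l.elim (Sum.inr Ctrl.out1) Sum.inl), (c.var, none), mkStk c.stk [] [] ctx []⟩

/-- One statement of the embedded machine is simulated exactly by its translation. [folklore] -/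
theorem stepAux_trStmt [DecidableEq K] (q : TM2.Stmt G Λ σ) (v : σ) (S : ∀ k, List (G k))
    (ctx : List (Option A)) :
    TM2.stepAux (trStmt (A := A) q) (v, none) (mkStk S [] [] ctx []) =
      cfgM (TM2.stepAux q v S) ctx := by
  induction q generalizing v S with
  | push k f q ih =>
    simp only [trStmt, TM2.stepAux]
    rw [← ih, mkStk_inl, mkStk_update_inl]
  | peek k f q ih => simp only [trStmt, TM2.stepAux]; exact ih _ _
  | pop k f q ih =>
    simp only [trStmt, TM2.stepAux]
    rw [← ih, mkStk_inl, mkStk_update_inl]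
  | load f q ih => simp only [trStmt, TM2.stepAux]; exact ih _ _
  | branch p q₁ q₂ ih₁ ih₂ =>
    simp only [trStmt, TM2.stepAux]
    cases p v
    · exact ih₂ _ _
    · exact ih₁ _ _
  | goto l => rfl
  | halt => rfl

variable [Inhabited A] (k₀ k₁ : K) (eIn : G k₀ ≃ A) (eOut : G k₁ ≃ A) (main : Λ) (init : σ)

/-- The control statements of the context machine.
* `init1`: move the data symbols of the first field from `IN` to `TMP`, up to the terminator;
* `init2`: move the rest of `IN` (the context) to `CTX`;
* `init3`: move `TMP` onto the input stack `k₀` of the embedded machine (restoring the order)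
  and start the embedded machine at `main`;
* `out1`: move `CTX` onto `OUT` (restoring the order); `out2`: push the terminator;
* `out3`, `out4`: move the output stack `k₁` of the embedded machine via `TMP` onto `OUT`, as
  data symbols;
* `fin`: reset the state and halt.
Every control statement resets the symbol register before jumping. [folklore] -/
def ctrlStmt : Ctrl → TM2.Stmt (CtxΓ G A) (Λ ⊕ Ctrl) (St σ A)
  | Ctrl.init1 =>
      TM2.Stmt.pop (Sum.inr Aux.IN) (fun v a => (v.1, a)) <|
        TM2.Stmt.branch (fun v => v.2.isNone)
          (TM2.Stmt.load rst <| TM2.Stmt.goto fun _ => Sum.inr Ctrl.init3) <|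
          TM2.Stmt.branch (fun v => isCnt v.2)
            (TM2.Stmt.load rst <| TM2.Stmt.goto fun _ => Sum.inr Ctrl.init2)
            (TM2.Stmt.push (Sum.inr Aux.TMP) (fun v => iget v.2) <| TM2.Stmt.load rst <|
              TM2.Stmt.goto fun _ => Sum.inr Ctrl.init1)
  | Ctrl.init2 =>
      TM2.Stmt.pop (Sum.inr Aux.IN) (fun v a => (v.1, a)) <|
        TM2.Stmt.branch (fun v => v.2.isNone)
          (TM2.Stmt.load rst <| TM2.Stmt.goto fun _ => Sum.inr Ctrl.init3)
          (TM2.Stmt.push (Sum.inr Aux.CTX) (fun v => ijoin v.2) <| TM2.Stmt.load rst <|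
            TM2.Stmt.goto fun _ => Sum.inr Ctrl.init2)
  | Ctrl.init3 =>
      TM2.Stmt.pop (Sum.inr Aux.TMP) (fun v a => (v.1, a.map some)) <|
        TM2.Stmt.branch (fun v => v.2.isNone)
          (TM2.Stmt.load rst <| TM2.Stmt.goto fun _ => Sum.inl main)
          (TM2.Stmt.push (Sum.inl k₀) (fun v => eIn.symm (iget v.2)) <| TM2.Stmt.load rst <|
            TM2.Stmt.goto fun _ => Sum.inr Ctrl.init3)
  | Ctrl.out1 =>
      TM2.Stmt.pop (Sum.inr Aux.CTX) (fun v a => (v.1, a)) <|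
        TM2.Stmt.branch (fun v => v.2.isNone)
          (TM2.Stmt.load rst <| TM2.Stmt.goto fun _ => Sum.inr Ctrl.out2)
          (TM2.Stmt.push (Sum.inr Aux.OUT) (fun v => ijoin v.2) <| TM2.Stmt.load rst <|
            TM2.Stmt.goto fun _ => Sum.inr Ctrl.out1)
  | Ctrl.out2 =>
      TM2.Stmt.push (Sum.inr Aux.OUT) (fun _ => none) <| TM2.Stmt.load rst <|
        TM2.Stmt.goto fun _ => Sum.inr Ctrl.out3
  | Ctrl.out3 =>
      TM2.Stmt.pop (Sum.inl k₁) (fun v a => (v.1, a.map fun g => some (eOut g))) <|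
        TM2.Stmt.branch (fun v => v.2.isNone)
          (TM2.Stmt.load rst <| TM2.Stmt.goto fun _ => Sum.inr Ctrl.out4)
          (TM2.Stmt.push (Sum.inr Aux.TMP) (fun v => iget v.2) <| TM2.Stmt.load rst <|
            TM2.Stmt.goto fun _ => Sum.inr Ctrl.out3)
  | Ctrl.out4 =>
      TM2.Stmt.pop (Sum.inr Aux.TMP) (fun v a => (v.1, a.map some)) <|
        TM2.Stmt.branch (fun v => v.2.isNone)
          (TM2.Stmt.load rst <| TM2.Stmt.goto fun _ => Sum.inr Ctrl.fin)
          (TM2.Stmt.push (Sum.inr Aux.OUT) (fun v => some (iget v.2)) <| TM2.Stmt.load rst <|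
            TM2.Stmt.goto fun _ => Sum.inr Ctrl.out4)
  | Ctrl.fin => TM2.Stmt.load (fun _ => (init, none)) TM2.Stmt.halt

end Machine

/-! ### Bundling: the context machine as a `FinTM2` -/

section Bundled

variable (M : FinTM2) (A : Type)

/-- Configurations of the context machine with a reset symbol register, from the label, the
`M`-state, the stacks of `M` and the four auxiliary stacks. [folklore] -/
def cfg (l : Option (M.Λ ⊕ Ctrl)) (v : M.σ) (S : ∀ k, List (M.Γ k)) (i : List (Option A))
    (t : List A) (c o : List (Option A)) : TM2.Cfg (CtxΓ M.Γ A) (M.Λ ⊕ Ctrl) (St M.σ A) :=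
  ⟨l, (v, none), mkStk S i t c o⟩

/-- The (unbundled) type of configurations of the context machine. [folklore] -/
abbrev LCfg : Type := TM2.Cfg (CtxΓ M.Γ A) (M.Λ ⊕ Ctrl) (St M.σ A)

variable {A} [Inhabited A] (eIn : M.Γ M.k₀ ≃ A) (eOut : M.Γ M.k₁ ≃ A)

/-- The context machine of a bundled TM2 machine `M` whose input and output alphabets are
identified with `A`: stacks `M.K ⊕ Aux` (input stack `inr IN`, output stack `inr OUT`, both
over `Option A`), labels `M.Λ ⊕ Ctrl` (main label `init1`), states `M.σ × Option (Option A)`.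
On input `u.map some ++ none :: c` it runs `M` on `u` and outputs `y.map some ++ none :: c`,
where `y` is the output of `M` on `u`.
[cite: AroraBarak2009, §1.3 (multi-tape machines; running a machine as a subroutine)] -/
noncomputable def ctxTM : FinTM2 :=
  letI := M.kFin; letI := M.ΛFin; letI := M.σFin; letI := M.Γk₀Fin
  letI : Fintype A := Fintype.ofEquiv _ eIn
  { K := M.K ⊕ Aux
    k₀ := Sum.inr Aux.IN
    k₁ := Sum.inr Aux.OUT
    Γ := CtxΓ M.Γ A
    Λ := M.Λ ⊕ Ctrl
    main := Sum.inr Ctrl.init1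
    σ := St M.σ A
    initialState := (M.initialState, none)
    Γk₀Fin := (inferInstance : Fintype (Option A))
    m := fun l => match l with
      | Sum.inl l => trStmt (M.m l)
      | Sum.inr c => ctrlStmt M.k₀ M.k₁ eIn eOut M.main M.initialState c }

/-- A step of the context machine at a control label, unbundled. [folklore] -/
theorem step_inr (c : Ctrl) (var : St M.σ A) (stk : ∀ j, List (CtxΓ M.Γ A j)) :
    (ctxTM M eIn eOut).step
        (⟨some (Sum.inr c), var, stk⟩ : TM2.Cfg (CtxΓ M.Γ A) (M.Λ ⊕ Ctrl) (St M.σ A)) =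
      some (TM2.stepAux (ctrlStmt M.k₀ M.k₁ eIn eOut M.main M.initialState c) var stk) :=
  rfl

/-- A step of the context machine at a label of the embedded machine, unbundled. [folklore] -/
theorem step_inl (l : M.Λ) (var : St M.σ A) (stk : ∀ j, List (CtxΓ M.Γ A j)) :
    (ctxTM M eIn eOut).step
        (⟨some (Sum.inl l), var, stk⟩ : TM2.Cfg (CtxΓ M.Γ A) (M.Λ ⊕ Ctrl) (St M.σ A)) =
      some (TM2.stepAux (trStmt (M.m l)) var stk) :=
  rfl

/-! ### Single steps of the control labels -/

section Steps

variable (v : M.σ) (S : ∀ k, List (M.Γ k)) (i : List (Option A)) (t : List A)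
  (c o : List (Option A))

/-- `init1` on a data symbol: move it to `TMP`. [folklore] -/
theorem step_init1_some (s : A) :
    (ctxTM M eIn eOut).step (cfg M A (some (Sum.inr Ctrl.init1)) v S (some s :: i) t c o) =
      some (cfg M A (some (Sum.inr Ctrl.init1)) v S i (s :: t) c o) := by
  rw [cfg, step_inr]; simp [ctrlStmt, rst, iget, isCnt, cfg]

/-- `init1` on the terminator: discard it and proceed to `init2`. [folklore] -/
theorem step_init1_none :
    (ctxTM M eIn eOut).step (cfg M A (some (Sum.inr Ctrl.init1)) v S (none :: i) t c o) =
      some (cfg M A (some (Sum.inr Ctrl.init2)) v S i t c o) := by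
  rw [cfg, step_inr]; simp [ctrlStmt, rst, isCnt, cfg]

/-- `init2` on a context symbol: move it to `CTX`. [folklore] -/
theorem step_init2_cons (s : Option A) :
    (ctxTM M eIn eOut).step (cfg M A (some (Sum.inr Ctrl.init2)) v S (s :: i) t c o) =
      some (cfg M A (some (Sum.inr Ctrl.init2)) v S i t (s :: c) o) := by
  rw [cfg, step_inr]; simp [ctrlStmt, rst, ijoin, cfg]

/-- `init2` on empty `IN`: proceed to `init3`. [folklore] -/
theorem step_init2_nil :
    (ctxTM M eIn eOut).step (cfg M A (some (Sum.inr Ctrl.init2)) v S [] t c o) =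
      some (cfg M A (some (Sum.inr Ctrl.init3)) v S [] t c o) := by
  rw [cfg, step_inr]; simp [ctrlStmt, rst, cfg]

/-- `init3` on nonempty `TMP`: move one symbol to `k₀` (through `eIn.symm`). [folklore] -/
theorem step_init3_cons (s : A) :
    (ctxTM M eIn eOut).step (cfg M A (some (Sum.inr Ctrl.init3)) v S i (s :: t) c o) =
      some (cfg M A (some (Sum.inr Ctrl.init3)) v
        (update S M.k₀ (eIn.symm s :: S M.k₀)) i t c o) := by
  rw [cfg, step_inr]; simp [ctrlStmt, rst, iget, cfg]

/-- `init3` on empty `TMP`: jump to the main label of `M`. [folklore] -/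
theorem step_init3_nil :
    (ctxTM M eIn eOut).step (cfg M A (some (Sum.inr Ctrl.init3)) v S i [] c o) =
      some (cfg M A (some (Sum.inl M.main)) v S i [] c o) := by
  rw [cfg, step_inr]; simp [ctrlStmt, rst, cfg]

/-- `out1` on nonempty `CTX`: move one context symbol to `OUT`. [folklore] -/
theorem step_out1_cons (s : Option A) :
    (ctxTM M eIn eOut).step (cfg M A (some (Sum.inr Ctrl.out1)) v S i t (s :: c) o) =
      some (cfg M A (some (Sum.inr Ctrl.out1)) v S i t c (s :: o)) := by
  rw [cfg, step_inr]; simp [ctrlStmt, rst, ijoin, cfg]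

/-- `out1` on empty `CTX`: proceed to `out2`. [folklore] -/
theorem step_out1_nil :
    (ctxTM M eIn eOut).step (cfg M A (some (Sum.inr Ctrl.out1)) v S i t [] o) =
      some (cfg M A (some (Sum.inr Ctrl.out2)) v S i t [] o) := by
  rw [cfg, step_inr]; simp [ctrlStmt, rst, cfg]

/-- `out2`: push the terminator onto `OUT` and proceed to `out3`. [folklore] -/
theorem step_out2 :
    (ctxTM M eIn eOut).step (cfg M A (some (Sum.inr Ctrl.out2)) v S i t c o) =
      some (cfg M A (some (Sum.inr Ctrl.out3)) v S i t c (none :: o)) := by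
  rw [cfg, step_inr]; simp [ctrlStmt, rst, cfg]

/-- `out3` on nonempty `k₁`: move one symbol to `TMP` (through `eOut`). [folklore] -/
theorem step_out3_cons (g : M.Γ M.k₁) (L : List (M.Γ M.k₁)) :
    (ctxTM M eIn eOut).step
        (cfg M A (some (Sum.inr Ctrl.out3)) v (update S M.k₁ (g :: L)) i t c o) =
      some (cfg M A (some (Sum.inr Ctrl.out3)) v (update S M.k₁ L) i (eOut g :: t) c o) := by
  rw [cfg, step_inr]; simp [ctrlStmt, rst, iget, cfg]

/-- `out3` on empty `k₁`: proceed to `out4`. [folklore] -/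
theorem step_out3_nil :
    (ctxTM M eIn eOut).step (cfg M A (some (Sum.inr Ctrl.out3)) v (update S M.k₁ []) i t c o) =
      some (cfg M A (some (Sum.inr Ctrl.out4)) v (update S M.k₁ []) i t c o) := by
  rw [cfg, step_inr]; simp [ctrlStmt, rst, cfg]

/-- `out4` on nonempty `TMP`: move one symbol to `OUT` as a data symbol. [folklore] -/
theorem step_out4_cons (s : A) :
    (ctxTM M eIn eOut).step (cfg M A (some (Sum.inr Ctrl.out4)) v S i (s :: t) c o) =
      some (cfg M A (some (Sum.inr Ctrl.out4)) v S i t c (some s :: o)) := by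
  rw [cfg, step_inr]; simp [ctrlStmt, rst, iget, cfg]

/-- `out4` on empty `TMP`: proceed to `fin`. [folklore] -/
theorem step_out4_nil :
    (ctxTM M eIn eOut).step (cfg M A (some (Sum.inr Ctrl.out4)) v S i [] c o) =
      some (cfg M A (some (Sum.inr Ctrl.fin)) v S i [] c o) := by
  rw [cfg, step_inr]; simp [ctrlStmt, rst, cfg]

/-- `fin`: reset the state and halt. [folklore] -/
theorem step_fin :
    (ctxTM M eIn eOut).step (cfg M A (some (Sum.inr Ctrl.fin)) v S i t c o) =
      some (cfg M A none M.initialState S i t c o) := by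
  rw [cfg, step_inr]; simp [ctrlStmt, cfg]

/-- A step of the embedded machine `M` is a step of the context machine on the embedded
configuration. [folklore] -/
theorem step_cfgM (a b : M.Cfg) (h : M.step a = some b) (ctx : List (Option A)) :
    (ctxTM M eIn eOut).step (cfgM (A := A) a ctx) = some (cfgM b ctx) := by
  obtain ⟨_ | l, w, S'⟩ := a
  · simp [FinTM2.step, TM2.step] at h
  · simp only [FinTM2.step, TM2.step] at h
    obtain rfl := Option.some.inj h
    simp only [cfgM, Option.elim]
    rw [step_inl, stepAux_trStmt]
    rfl

end Steps

/-! ### Phases of the context machine -/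

section Phases

variable (v : M.σ) (S : ∀ k, List (M.Γ k))

/-- `init1`: the data symbols of the first field are moved (reversed) onto `TMP`. [folklore] -/
theorem init1_data (xs : List A) (rest : List (Option A)) (t : List A) (c o : List (Option A)) :
    ReachesIn (C := LCfg M A) (ctxTM M eIn eOut).step
      (cfg M A (some (Sum.inr Ctrl.init1)) v S (xs.map some ++ rest) t c o)
      (cfg M A (some (Sum.inr Ctrl.init1)) v S rest (xs.reverse ++ t) c o) xs.length := by
  induction xs generalizing t with
  | nil => simpa using ReachesIn.refl _ _
  | cons x xs ih =>
    simpa [List.append_assoc] using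
      ReachesIn.step_trans (step_init1_some M eIn eOut v S (xs.map some ++ rest) t c o x)
        (ih (x :: t))

/-- `init2`: the context is moved (reversed) onto `CTX`, then the machine proceeds to `init3`.
[folklore] -/
theorem init2_run (ctx : List (Option A)) (t : List A) (c o : List (Option A)) :
    ReachesIn (C := LCfg M A) (ctxTM M eIn eOut).step
      (cfg M A (some (Sum.inr Ctrl.init2)) v S ctx t c o)
      (cfg M A (some (Sum.inr Ctrl.init3)) v S [] t (ctx.reverse ++ c) o) (ctx.length + 1) := by
  induction ctx generalizing c with
  | nil => simpa using ReachesIn.single (step_init2_nil M eIn eOut v S t c o)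
  | cons s ctx ih =>
    simpa [List.append_assoc] using
      ReachesIn.step_trans (step_init2_cons M eIn eOut v S ctx t c o s) (ih (s :: c))

/-- `init3`: `TMP` is moved (reversed, written through `eIn`) on top of the input stack `k₀` of
`M`, then the machine jumps to the main label of `M`. [folklore] -/
theorem init3_run (i : List (Option A)) (t : List A) (c o : List (Option A)) :
    ReachesIn (C := LCfg M A) (ctxTM M eIn eOut).step
      (cfg M A (some (Sum.inr Ctrl.init3)) v S i t c o)
      (cfg M A (some (Sum.inl M.main)) v (update S M.k₀ (t.reverse.map eIn.symm ++ S M.k₀))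
        i [] c o) (t.length + 1) := by
  induction t generalizing S with
  | nil =>
    simpa using ReachesIn.single (step_init3_nil M eIn eOut v S i c o)
  | cons s t ih =>
    have := ih (update S M.k₀ (eIn.symm s :: S M.k₀))
    rw [update_idem, update_self] at this
    simpa [List.append_assoc] using
      ReachesIn.step_trans (step_init3_cons M eIn eOut v S i t c o s) this

/-- `out1`: `CTX` is moved (reversed) onto `OUT`, then the machine proceeds to `out2`.
[folklore] -/
theorem out1_run (i : List (Option A)) (t : List A) (c o : List (Option A)) :
    ReachesIn (C := LCfg M A) (ctxTM M eIn eOut).step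
      (cfg M A (some (Sum.inr Ctrl.out1)) v S i t c o)
      (cfg M A (some (Sum.inr Ctrl.out2)) v S i t [] (c.reverse ++ o)) (c.length + 1) := by
  induction c generalizing o with
  | nil => simpa using ReachesIn.single (step_out1_nil M eIn eOut v S i t o)
  | cons s c ih =>
    simpa [List.append_assoc] using
      ReachesIn.step_trans (step_out1_cons M eIn eOut v S i t c o s) (ih (s :: o))

/-- `out3`: the output stack `k₁` of `M` is moved (reversed, read through `eOut`) onto `TMP`,
then the machine proceeds to `out4`. [folklore] -/
theorem out3_run (L : List (M.Γ M.k₁)) (i : List (Option A)) (t : List A)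
    (c o : List (Option A)) :
    ReachesIn (C := LCfg M A) (ctxTM M eIn eOut).step
      (cfg M A (some (Sum.inr Ctrl.out3)) v (update S M.k₁ L) i t c o)
      (cfg M A (some (Sum.inr Ctrl.out4)) v (update S M.k₁ []) i (L.reverse.map eOut ++ t) c o)
      (L.length + 1) := by
  induction L generalizing t with
  | nil => simpa using ReachesIn.single (step_out3_nil M eIn eOut v S i t c o)
  | cons g L ih =>
    simpa [List.append_assoc] using
      ReachesIn.step_trans (step_out3_cons M eIn eOut v S i t c o g L) (ih (eOut g :: t))

/-- `out4`: `TMP` is moved (reversed) onto `OUT` as data symbols, then the machine proceeds to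
`fin`. [folklore] -/
theorem out4_run (i : List (Option A)) (t : List A) (c o : List (Option A)) :
    ReachesIn (C := LCfg M A) (ctxTM M eIn eOut).step
      (cfg M A (some (Sum.inr Ctrl.out4)) v S i t c o)
      (cfg M A (some (Sum.inr Ctrl.fin)) v S i [] c (t.reverse.map some ++ o)) (t.length + 1) := by
  induction t generalizing o with
  | nil => simpa using ReachesIn.single (step_out4_nil M eIn eOut v S i c o)
  | cons s t ih =>
    simpa [List.append_assoc] using
      ReachesIn.step_trans (step_out4_cons M eIn eOut v S i t c o s) (ih (some s :: o))

/-- A run of the embedded machine `M` is a run of the context machine on embedded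
configurations. [folklore] -/
theorem run_cfgM {n : ℕ} {a b : M.Cfg} (h : (flip bind M.step)^[n] (some a) = some b)
    (ctx : List (Option A)) :
    (flip bind (ctxTM M eIn eOut).step)^[n] (some (cfgM (A := A) a ctx)) =
      some (cfgM b ctx) :=
  iterate_bind_map M.step (ctxTM M eIn eOut).step (fun x => cfgM x ctx)
    (fun x y hxy => step_cfgM M eIn eOut x y hxy ctx) n a b h

/-- The initial configuration of the context machine. [folklore] -/
theorem initList_ctxTM (l : List (Option A)) :
    initList (ctxTM M eIn eOut) l =
      cfg M A (some (Sum.inr Ctrl.init1)) M.initialState (fun _ => []) l [] [] [] := by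
  rw [initList_eq]
  change (⟨some (Sum.inr Ctrl.init1), (M.initialState, none),
      update (fun j => ([] : List (CtxΓ M.Γ A j))) (Sum.inr Aux.IN) l⟩ :
      TM2.Cfg (CtxΓ M.Γ A) (M.Λ ⊕ Ctrl) (St M.σ A)) = _
  rw [← mkStk_bot_IN]
  rfl

/-- The halting configuration of the context machine. [folklore] -/
theorem haltList_ctxTM (l : List (Option A)) :
    haltList (ctxTM M eIn eOut) l =
      cfg M A none M.initialState (fun _ => []) [] [] [] l := by
  rw [haltList_eq]
  change (⟨none, (M.initialState, none),
      update (fun j => ([] : List (CtxΓ M.Γ A j))) (Sum.inr Aux.OUT) l⟩ :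
      TM2.Cfg (CtxΓ M.Γ A) (M.Λ ⊕ Ctrl) (St M.σ A)) = _
  rw [← mkStk_bot_OUT]
  rfl

omit [Inhabited A] in
/-- The embedded initial configuration of `M` on input `l`, with context stack `ctx`.
[folklore] -/
theorem cfgM_initList (l : List (M.Γ M.k₀)) (ctx : List (Option A)) :
    cfgM (A := A) (initList M l) ctx =
      cfg M A (some (Sum.inl M.main)) M.initialState (update (fun _ => []) M.k₀ l) [] [] ctx [] :=
  by rw [initList_eq]; rfl

omit [Inhabited A] in
/-- The embedded halting configuration of `M` with output `L`, with context stack `ctx`: the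
context machine is at `out1`. [folklore] -/
theorem cfgM_haltList (L : List (M.Γ M.k₁)) (ctx : List (Option A)) :
    cfgM (A := A) (haltList M L) ctx =
      cfg M A (some (Sum.inr Ctrl.out1)) M.initialState (update (fun _ => []) M.k₁ L) [] []
        ctx [] := by
  rw [haltList_eq]; rfl

/-- **The whole run.** If `M` maps `u` to `y` within `m` steps (from `initList` to `haltList`),
then on input `u.map some ++ none :: ctx` the context machine halts with output
`y.map some ++ none :: ctx` within `2|u| + 2|ctx| + 2|y| + m + 8` steps. [folklore] -/
theorem run_all {u y : List A} {m : ℕ} (ctx : List (Option A))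
    (h : ReachesIn M.step (initList M (u.map eIn.symm)) (haltList M (y.map eOut.symm)) m) :
    ReachesIn (C := LCfg M A) (ctxTM M eIn eOut).step
      (initList (ctxTM M eIn eOut) (u.map some ++ none :: ctx))
      (haltList (ctxTM M eIn eOut) (y.map some ++ none :: ctx))
      (2 * u.length + 2 * ctx.length + 2 * y.length + m + 8) := by
  obtain ⟨k, hk, e⟩ := h
  rw [initList_ctxTM, haltList_ctxTM]
  -- init1: data symbols to `TMP`, then the terminator
  have h1 := init1_data M eIn eOut M.initialState (fun _ => []) u (none :: ctx) [] [] []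
  have h2 := ReachesIn.single
    (step_init1_none M eIn eOut M.initialState (fun _ => []) ctx (u.reverse ++ []) [] [])
  -- init2: context to `CTX`
  have h3 := init2_run M eIn eOut M.initialState (fun _ => []) ctx (u.reverse ++ []) [] []
  -- init3: `TMP` to `k₀`, i.e. the initial configuration of `M`
  have h4 := init3_run M eIn eOut M.initialState (fun _ => []) [] (u.reverse ++ [])
    (ctx.reverse ++ []) []
  simp only [List.append_nil, List.reverse_reverse, List.length_reverse] at h1 h2 h3 h4
  rw [← cfgM_initList] at h4
  -- run `M`
  have h5 : ReachesIn (C := LCfg M A) (ctxTM M eIn eOut).step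
      (cfgM (initList M (u.map eIn.symm)) ctx.reverse)
      (cfgM (haltList M (y.map eOut.symm)) ctx.reverse) m :=
    ⟨k, hk, run_cfgM M eIn eOut e _⟩
  rw [cfgM_haltList] at h5
  -- out1: `CTX` to `OUT`; out2: terminator
  have h6 := out1_run M eIn eOut M.initialState (update (fun _ => []) M.k₁ (y.map eOut.symm))
    [] [] ctx.reverse []
  rw [List.reverse_reverse, List.append_nil, List.length_reverse] at h6
  have h7 := ReachesIn.single (step_out2 M eIn eOut M.initialState
    (update (fun _ => []) M.k₁ (y.map eOut.symm)) [] [] [] ctx)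
  -- out3: `k₁` to `TMP`; out4: `TMP` to `OUT`; fin
  have h8 := out3_run M eIn eOut M.initialState (fun _ => []) (y.map eOut.symm) [] [] []
    (none :: ctx)
  rw [update_eq_self] at h8
  have hy : (y.map eOut.symm).reverse.map eOut ++ [] = y.reverse := by simp [List.map_reverse]
  rw [hy, List.length_map] at h8
  have h9 := out4_run M eIn eOut M.initialState (fun _ => []) [] y.reverse [] (none :: ctx)
  rw [List.reverse_reverse, List.length_reverse] at h9
  have h10 := ReachesIn.single (step_fin M eIn eOut M.initialState (fun _ => []) [] [] []
    (y.map some ++ none :: ctx))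
  have := ((((((((h1.trans h2).trans h3).trans h4).trans h5).trans h6).trans h7).trans h8).trans
    h9).trans h10
  refine this.mono ?_
  omega

end Phases

end Bundled

/-! ### The context machine computes `Prod.map f id` on field encodings -/

section Main

variable {α β γ A : Type} [Inhabited A] {ea : α → List A} {eb : β → List A}
  {ec : γ → List (Option A)} {f : α → β}
  (Mx : TM2ComputableAux A A) (p : Polynomial ℕ)
  (hF : ∀ a, Mx.OutputsWithin (ea a) (eb (f a)) (p.eval (ea a).length))

/-- The context machine of `Mx : TM2ComputableAux A A`, as a machine with input and output
alphabet `Option A`. [folklore] -/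
noncomputable def ctxAux : TM2ComputableAux (Option A) (Option A) :=
  ⟨ctxTM Mx.tm Mx.inputAlphabet Mx.outputAlphabet, Equiv.refl _, Equiv.refl _⟩

/-- The running-time polynomial of the context machine in terms of the time polynomial `p` of
the embedded machine and its push bound `D`: `6N + 8 + (2D + 1) p N`. [folklore] -/
noncomputable def ctxPoly (p : Polynomial ℕ) (D : ℕ) : Polynomial ℕ :=
  6 * Polynomial.X + 8 + Polynomial.C (2 * D + 1) * p

/-- Evaluation of `ctxPoly`. [folklore] -/
theorem ctxPoly_eval (p : Polynomial ℕ) (D N : ℕ) :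
    (ctxPoly p D).eval N = 6 * N + 8 + (2 * D + 1) * p.eval N := by
  simp [ctxPoly]

include hF in
/-- **Correctness and running time of the context machine.** On input
`(ea a).map some ++ none :: ec c` the context machine halts with output
`(eb (f a)).map some ++ none :: ec c` within `(ctxPoly p D).eval` of the input length, where
`D = machinePushBound Mx.tm`. [folklore] -/
theorem ctxAux_outputsWithin (a : α) (c : γ) :
    (ctxAux Mx).OutputsWithin ((ea a).map some ++ none :: ec c)
      ((eb (f a)).map some ++ none :: ec c)
      ((ctxPoly p (machinePushBound Mx.tm)).eval ((ea a).map some ++ none :: ec c).length) := by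
  apply outputsWithin_of_reachesIn
  have hin : ((ea a).map some ++ none :: ec c).map (ctxAux Mx).inputAlphabet.symm =
      (ea a).map some ++ none :: ec c := List.map_id _
  have hout : ((eb (f a)).map some ++ none :: ec c).map (ctxAux Mx).outputAlphabet.symm =
      (eb (f a)).map some ++ none :: ec c := List.map_id _
  rw [hin, hout]
  have h := run_all Mx.tm Mx.inputAlphabet Mx.outputAlphabet (ec c)
    (reachesIn_of_outputsWithin Mx (hF a))
  refine h.mono ?_
  -- the polynomial bound, in terms of `N = |ea a| + 1 + |ec c|`
  have hlen := (hF a).length_le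
  rw [List.length_append, List.length_map, List.length_cons, ctxPoly_eval]
  set L := (ea a).length
  set Cx := (ec c).length
  set D := machinePushBound Mx.tm
  have hp : p.eval L ≤ p.eval (L + (Cx + 1)) := eval_mono p (Nat.le_add_right _ _)
  have hD : D * p.eval L ≤ D * p.eval (L + (Cx + 1)) := Nat.mul_le_mul_left D hp
  have e1 : (2 * D + 1) * p.eval (L + (Cx + 1)) =
      2 * (D * p.eval (L + (Cx + 1))) + p.eval (L + (Cx + 1)) := by ring
  omega

/-- **Running a polynomial-time machine on the first field, keeping a typed context.**
If `f : α → β` is computed in polynomial time (w.r.t. encodings `ea`, `eb` over a nonempty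
alphabet `A`), then for every context type `γ` with an encoding `ec : γ → List (Option A)` the
map `(a, c) ↦ (f a, c)` is computed in polynomial time on the field encodings
`(ea a).map some ++ none :: ec c ↦ (eb (f a)).map some ++ none :: ec c` — by the context
machine `ctxTM`, which parks the context on a separate stack while the machine of `f` runs.
This is the "run a machine as a subroutine on part of the tape" step of standard multi-tape
constructions. [cite: AroraBarak2009, §1.3 (multi-tape machines; subroutines) and Claim 1.6] -/
theorem _root_.Literature.Computability.Complexity.PolyTimeComputable.firstField {α β γ A : Type} [Inhabited A]
    {ea : α → List A} {eb : β → List A} (ec : γ → List (Option A)) {f : α → β}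
    (hf : PolyTimeComputable ea eb f) :
    PolyTimeComputable (fun q : α × γ => (ea q.1).map some ++ none :: ec q.2)
      (fun q : β × γ => (eb q.1).map some ++ none :: ec q.2) (Prod.map f id) := by
  obtain ⟨p, Mx, h⟩ := hf
  exact ⟨ctxPoly p (machinePushBound Mx.tm), ctxAux Mx,
    fun q => ctxAux_outputsWithin Mx p h q.1 q.2⟩

end Main

end TM2Ctx

end Literature.Computability.Complexity
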